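import Summits.MatrixMultiplication.MatrixMultiplication.Theses.DesignFlattening

/-!
# MatrixMultiplication / DesignFlattening — the assembly `Assembly` (stmt-MatrixMultiplication-8042)

Route `MatrixMultiplication/DesignFlattening`, item stmt-MatrixMultiplication-8042 (`Assembly`, rank 1):

  `HadamardRankLe → AddTableRankLe → GrowingHostDesigns → MatrixMultiplication`.

Proof (pure bookkeeping over proved cone facts, self-contained; the statement is, verbatim, the type
of the route's kernel-checked deciding theorem
`Summit.MatrixMultiplication.MatrixMultiplication.Theses.DesignFlattening.closes`, which this file
follows but does not invoke). Fix `η > 0` and take from `GrowingHostDesigns` a finite abelian group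
`G`, a kept-cell set `P ⊆ G × G`, `p ≥ 1` blocks of `⟨m,m,m⟩` (`m ≥ 2`) hosted on the nose in the
punctured table `T_P = [b + c = a ∧ (b,c) ∈ P]` by index maps `α β γ`, and a completion `S` of the
`N`-th power (`N ≥ 1`), `T_P^{⊗N} = U_G^{⊗N} ∘ S` entrywise, of cost `|G|^N · R(S) ≤ (p · m^{2+η})^N`.

* Step 1 — hosting on the nose is a pull-back along `(α, β, γ)`, hence a restriction
  (`tensorRestrictsTo_precomp`), so `R((p ⊙ ⟨m,m,m⟩)^{⊗N}) ≤ R(T_P^{⊗N})`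
  (`TensorRestrictsTo.tensorRank_le`);
* Step 2 — the completion identity and `HadamardRankLe`: `R(T_P^{⊗N}) ≤ R(U_G^{⊗N}) · R(S)`;
* Step 3 — `U_G^{⊗N}` is the addition table of the group `Fin N → G`, so `AddTableRankLe` gives
  `R(U_G^{⊗N}) ≤ |G|^N`;
* Step 4 — hence `R((p ⊙ ⟨m,m,m⟩)^{⊗N}) ≤ |G|^N · R(S) ≤ (p · m^{2+η})^N`;
* Step 5 — `R̃` is the infimum of `R(t^{⊗N})^{1/N}`, so `R̃(p ⊙ ⟨m,m,m⟩) ≤ p · m^{2+η}`;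
* Step 6 — Schönhage's asymptotic sum inequality in asymptotic-rank form
  (`sum_rpow_omega_le_asymptoticRank`, proved in the tree): `p · m^ω ≤ R̃(p ⊙ ⟨m,m,m⟩)`, so
  `m^ω ≤ m^{2+η}` and (`m ≥ 2`) `ω(ℂ) ≤ 2 + η`.

All `η > 0`: `ω(ℂ) ≤ 2`; with the flattening bound `omega_two_le` (`2 ≤ ω(ℂ)`), `ω(ℂ) = 2`, which is
`MatrixMultiplication` (`MatrixMultiplication_iff`).

References: D. Coppersmith, S. Winograd, *Matrix multiplication via arithmetic progressions*,
J. Symb. Comput. 9 (1990), §11; M. Bläser, *Fast Matrix Multiplication*, ToC Graduate Surveys 5 (2013),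
§5, §7, §9.2; J. Alman, R. Duan, V. Vassilevska Williams, Y. Xu, Z. Xu, R. Zhou, SODA 2025, Thm. 3.1
(asymptotic sum inequality); P. Bürgisser, M. Clausen, M. A. Shokrollahi, *Algebraic Complexity
Theory* (1997), Ex. 15.24(7), Ex. 15.25.
-/

-- the tree's namespace `Summit.MatrixMultiplication.MatrixMultiplication.…` repeats a component by design
set_option linter.dupNamespace false

namespace Summit.MatrixMultiplication.MatrixMultiplication.Theorems

open scoped BigOperators
open Summit.MatrixMultiplication.MatrixMultiplication.Theses.DesignFlattening
open Literature.Computability.AlgebraicComplexity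

/-- Step 3 of the assembly: the `N`-th Kronecker power of the addition table `U_G = [b + c = a]` of a
finite abelian group `G` is the addition table of the group `Fin N → G` (a product of indicators is
the indicator of the conjunction, `Finset.prod_boole`), so `AddTableRankLe` bounds its rank by
`|Fin N → G| = |G|^N`. [cite: CohnUmans2003, §2] -/
theorem designFlattening_tensorRank_kroneckerPow_addTable_le (hA : AddTableRankLe) (G : Type)
    [AddCommGroup G] [Fintype G] [DecidableEq G] (N : ℕ) :
    tensorRank (kroneckerPow (fun a b c : G => if b + c = a then (1 : ℂ) else 0) N) ≤
      Fintype.card G ^ N := by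
  have heq : kroneckerPow (fun a b c : G => if b + c = a then (1 : ℂ) else 0) N =
      fun c a b : Fin N → G => if a + b = c then (1 : ℂ) else 0 := by
    funext c a b
    simp only [kroneckerPow_apply]
    rw [Finset.prod_boole]
    by_cases h : a + b = c
    · have h' : ∀ i ∈ (Finset.univ : Finset (Fin N)), a i + b i = c i :=
        fun i _ => by rw [← h]; rfl
      rw [if_pos h', if_pos h]
    · have h' : ¬ ∀ i ∈ (Finset.univ : Finset (Fin N)), a i + b i = c i :=
        fun H => h (funext fun i => H i (Finset.mem_univ i))
      rw [if_neg h', if_neg h]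
  have hAN := hA (Fin N → G)
  rw [Fintype.card_fun, Fintype.card_fin] at hAN
  rw [heq]
  exact hAN

/-- Steps 1–4 of the assembly: if `p ⊙ ⟨m,m,m⟩` is hosted on the nose in the punctured table
`T_P = [b + c = a ∧ (b,c) ∈ P]` of a finite abelian group `G` by index maps `α β γ` and
`T_P^{⊗N} = U_G^{⊗N} ∘ S` entrywise, then `R((p ⊙ ⟨m,m,m⟩)^{⊗N}) ≤ |G|^N · R(S)`: the hosting is a
pull-back, hence a restriction (`tensorRestrictsTo_precomp`, `TensorRestrictsTo.tensorRank_le`),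
Hadamard products are rank-submultiplicative (`HadamardRankLe`), and `R(U_G^{⊗N}) ≤ |G|^N`
(`AddTableRankLe` on `Fin N → G`). [cite: CoppersmithWinograd1990, §11] [cite: Blaser2013, Def. 7.2] -/
theorem designFlattening_tensorRank_pow_blocks_le (hH : HadamardRankLe) (hA : AddTableRankLe)
    {G : Type} [AddCommGroup G] [Fintype G] [DecidableEq G] (P : Finset (G × G)) {p m : ℕ} (N : ℕ)
    (α β γ : (Σ _ : Fin p, Fin m × Fin m) → G)
    (hhost : ∀ x y z : (Σ _ : Fin p, Fin m × Fin m),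
      matMulDirectSum ℂ (fun _ : Fin p => m) (fun _ : Fin p => m) (fun _ : Fin p => m) x y z =
        (if β y + γ z = α x ∧ (β y, γ z) ∈ P then (1 : ℂ) else 0))
    (S : (Fin N → G) → (Fin N → G) → (Fin N → G) → ℂ)
    (hS : ∀ a b c : Fin N → G,
      kroneckerPow (fun a b c : G => if b + c = a ∧ (b, c) ∈ P then (1 : ℂ) else 0) N a b c =
        kroneckerPow (fun a b c : G => if b + c = a then (1 : ℂ) else 0) N a b c * S a b c) :
    tensorRank (kroneckerPow (matMulDirectSum ℂ (fun _ : Fin p => m) (fun _ : Fin p => m)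
        (fun _ : Fin p => m)) N) ≤ Fintype.card G ^ N * tensorRank S := by
  classical
  -- the three tensors: the direct sum `D = p ⊙ ⟨m,m,m⟩`, the punctured table `T`, the full table `U`
  set D := matMulDirectSum ℂ (fun _ : Fin p => m) (fun _ : Fin p => m) (fun _ : Fin p => m) with hD
  set T : G → G → G → ℂ := fun a b c => if b + c = a ∧ (b, c) ∈ P then (1 : ℂ) else 0 with hT
  set U : G → G → G → ℂ := fun a b c => if b + c = a then (1 : ℂ) else 0
  -- Step 1: `D^{⊗N}` is a relabelling of `T^{⊗N}`, so `R(D^{⊗N}) ≤ R(T^{⊗N})`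
  have h1 : tensorRank (kroneckerPow D N) ≤ tensorRank (kroneckerPow T N) := by
    have hres := tensorRestrictsTo_precomp (kroneckerPow T N)
      (fun a : Fin N → (Σ _ : Fin p, Fin m × Fin m) => α ∘ a)
      (fun b : Fin N → (Σ _ : Fin p, Fin m × Fin m) => β ∘ b)
      (fun c : Fin N → (Σ _ : Fin p, Fin m × Fin m) => γ ∘ c)
    have heq : kroneckerPow D N = fun a b c => kroneckerPow T N (α ∘ a) (β ∘ b) (γ ∘ c) := by
      funext a b c
      simp only [kroneckerPow_apply, Function.comp_apply, hT, hD]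
      exact Finset.prod_congr rfl fun i _ => hhost (a i) (b i) (c i)
    rw [heq]
    exact hres.tensorRank_le
  -- Step 2: `T^{⊗N} = U^{⊗N} ∘ S` entrywise, so `R(T^{⊗N}) ≤ R(U^{⊗N}) · R(S)`
  have h2 : tensorRank (kroneckerPow T N) ≤ tensorRank (kroneckerPow U N) * tensorRank S := by
    have heq : kroneckerPow T N = fun a b c => kroneckerPow U N a b c * S a b c := by
      funext a b c
      exact hS a b c
    rw [heq]
    exact hH _ _ _ _ S
  -- Step 3: `U^{⊗N}` is the addition table of `G^N`, so `R(U^{⊗N}) ≤ |G|^N`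
  have h3 : tensorRank (kroneckerPow U N) ≤ Fintype.card G ^ N :=
    designFlattening_tensorRank_kroneckerPow_addTable_le hA G N
  -- Step 4
  exact h1.trans (h2.trans (Nat.mul_le_mul_right _ h3))

/-- Step 5 of the assembly: the asymptotic rank `R̃(t) = inf_N R(t^{⊗N})^{1/N}` is at most `B` as
soon as ONE power satisfies `R(t^{⊗(N+1)}) ≤ B^{N+1}` (`ciInf_le` at `N`, then
`(B^{N+1})^{1/(N+1)} = B`). [cite: Blaser2013, §9.2] -/
theorem designFlattening_asymptoticRank_le_of_pow_le {ι κ μ : Type} [Fintype ι] [Fintype κ]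
    [Fintype μ] (t : ι → κ → μ → ℂ) {B : ℝ} (hB : 0 ≤ B) (N : ℕ)
    (h : (tensorRank (kroneckerPow t (N + 1)) : ℝ) ≤ B ^ (N + 1)) :
    asymptoticRank t ≤ B := by
  have hinf : asymptoticRank t ≤
      ((tensorRank (kroneckerPow t (N + 1)) : ℝ)) ^ ((N : ℝ) + 1)⁻¹ := by
    unfold asymptoticRank
    exact ciInf_le ⟨0, by rintro _ ⟨n, rfl⟩; positivity⟩ N
  refine hinf.trans ?_
  have hN1 : ((N : ℝ) + 1) = ((N + 1 : ℕ) : ℝ) := by push_cast; ring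
  calc ((tensorRank (kroneckerPow t (N + 1)) : ℝ)) ^ ((N : ℝ) + 1)⁻¹
      ≤ (B ^ (N + 1)) ^ ((N : ℝ) + 1)⁻¹ :=
        Real.rpow_le_rpow (by positivity) h (by positivity)
    _ = B := by
        rw [hN1]
        exact Real.pow_rpow_inv_natCast hB (Nat.succ_ne_zero N)

/-- Step 6 of the assembly: Schönhage's asymptotic sum inequality in asymptotic-rank form
(`sum_rpow_omega_le_asymptoticRank`, proved in the tree: `p · (m·m·m)^{ω/3} ≤ R̃(p ⊙ ⟨m,m,m⟩)`)
turns `R̃(p ⊙ ⟨m,m,m⟩) ≤ p · m^B` (`p ≥ 1`, `m ≥ 2`) into `m^ω ≤ m^B`, i.e. `ω(ℂ) ≤ B`.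
[cite: AlmanDuanVassilevskaWilliamsXuXuZhou2025, Thm. 3.1] [cite: BurgisserClausenShokrollahi1997, Ex. 15.24(7)] -/
theorem designFlattening_omega_le_of_asymptoticRank_blocks_le {p m : ℕ} (hp : 1 ≤ p) (hm : 2 ≤ m)
    {B : ℝ} (h : asymptoticRank (matMulDirectSum ℂ (fun _ : Fin p => m) (fun _ : Fin p => m)
      (fun _ : Fin p => m)) ≤ (p : ℝ) * (m : ℝ) ^ B) :
    omega ℂ ≤ B := by
  have h6 := sum_rpow_omega_le_asymptoticRank ℂ
    (fun _ : Fin p => m) (fun _ : Fin p => m) (fun _ : Fin p => m)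
  simp only [Finset.sum_const, Finset.card_univ, Fintype.card_fin, nsmul_eq_mul] at h6
  have hm0 : (0 : ℝ) ≤ (m : ℝ) := Nat.cast_nonneg m
  have hm1 : (1 : ℝ) < (m : ℝ) := by
    have : (2 : ℝ) ≤ (m : ℝ) := by exact_mod_cast hm
    linarith
  have hp0 : (0 : ℝ) < (p : ℝ) := by exact_mod_cast hp
  have hm3 : ((m * m * m : ℕ) : ℝ) ^ (omega ℂ / 3) = (m : ℝ) ^ omega ℂ := by
    have hc : ((m * m * m : ℕ) : ℝ) = (m : ℝ) ^ (3 : ℕ) := by push_cast; ring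
    rw [hc, ← Real.rpow_natCast, ← Real.rpow_mul hm0]
    congr 1
    push_cast
    ring
  rw [hm3] at h6
  -- `p · m^ω ≤ R̃(D) ≤ p · m^B`, so `m^ω ≤ m^B` and `ω ≤ B`
  have h7 : (p : ℝ) * (m : ℝ) ^ omega ℂ ≤ (p : ℝ) * (m : ℝ) ^ B := h6.trans h
  have h8 : (m : ℝ) ^ omega ℂ ≤ (m : ℝ) ^ B := le_of_mul_le_mul_left h7 hp0
  exact (Real.rpow_le_rpow_left_iff hm1).1 h8

/-- The glue inequality of route DesignFlattening: `HadamardRankLe`, `AddTableRankLe` and the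
growing-host design `GrowingHostDesigns` at `η > 0` give `ω(ℂ) ≤ 2 + η`
(`R((p ⊙ ⟨m,m,m⟩)^{⊗N}) ≤ |G|^N · R(S) ≤ (p · m^{2+η})^N`, hence `R̃(p ⊙ ⟨m,m,m⟩) ≤ p · m^{2+η}`, and
the asymptotic sum inequality). [cite: CoppersmithWinograd1990, §11] [cite: Blaser2013, Thm. 7.5] -/
theorem designFlattening_omega_le_two_add (hH : HadamardRankLe) (hA : AddTableRankLe)
    (hX : GrowingHostDesigns) {η : ℝ} (hη : 0 < η) : omega ℂ ≤ 2 + η := by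
  classical
  obtain ⟨G, _iG, _iF, _iD, P, p, m, N, hp, hm, hN, ⟨α, β, γ, hhost⟩, S, hS, hcost⟩ := hX η hη
  obtain ⟨N', rfl⟩ : ∃ N', N = N' + 1 := ⟨N - 1, (Nat.sub_add_cancel hN).symm⟩
  have h123 := designFlattening_tensorRank_pow_blocks_le hH hA P (N' + 1) α β γ hhost S hS
  -- Step 4: `R(D^{⊗N}) ≤ (p · m^{2+η})^N`
  have h4 : (tensorRank (kroneckerPow (matMulDirectSum ℂ (fun _ : Fin p => m) (fun _ : Fin p => m)
        (fun _ : Fin p => m)) (N' + 1)) : ℝ) ≤ ((p : ℝ) * (m : ℝ) ^ (2 + η)) ^ (N' + 1) := by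
    calc (tensorRank (kroneckerPow (matMulDirectSum ℂ (fun _ : Fin p => m) (fun _ : Fin p => m)
          (fun _ : Fin p => m)) (N' + 1)) : ℝ)
        ≤ ((Fintype.card G ^ (N' + 1) * tensorRank S : ℕ) : ℝ) := by exact_mod_cast h123
      _ = (Fintype.card G : ℝ) ^ (N' + 1) * (tensorRank S : ℝ) := by push_cast; ring
      _ ≤ ((p : ℝ) * (m : ℝ) ^ (2 + η)) ^ (N' + 1) := hcost
  have hpm : (0 : ℝ) ≤ (p : ℝ) * (m : ℝ) ^ (2 + η) := by positivity
  -- Steps 5–6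
  exact designFlattening_omega_le_of_asymptoticRank_blocks_le hp hm
    (designFlattening_asymptoticRank_le_of_pow_le _ hpm N' h4)

/-- **Assembly of route DesignFlattening** (item stmt-MatrixMultiplication-8042):
`HadamardRankLe → AddTableRankLe → GrowingHostDesigns → MatrixMultiplication`. For every `η > 0` the
growing-host design gives `R((p ⊙ ⟨m,m,m⟩)^{⊗N}) ≤ R(T_P^{⊗N}) = R(U_G^{⊗N} ∘ S) ≤ R(U_G^{⊗N}) · R(S)
≤ |G|^N · R(S) ≤ (p · m^{2+η})^N`, hence `R̃(p ⊙ ⟨m,m,m⟩) ≤ p · m^{2+η}` and, by the asymptotic sum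
inequality `p · m^ω ≤ R̃(p ⊙ ⟨m,m,m⟩)` with `p ≥ 1`, `m ≥ 2`, `ω(ℂ) ≤ 2 + η`; so `ω(ℂ) ≤ 2`, and
`ω(ℂ) ≥ 2` (flattening bound) makes it `ω(ℂ) = 2`, which is `MatrixMultiplication`
(`MatrixMultiplication_iff`). The statement is literally the type of the route's deciding theorem
`Theses.DesignFlattening.closes`; the proof here is self-contained.
[cite: CoppersmithWinograd1990, §11] [cite: Blaser2013, Thm. 7.5] -/
theorem designFlattening_assembly_proof :
    Summit.MatrixMultiplication.MatrixMultiplication.Theses.DesignFlattening.Assembly := by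
  unfold Summit.MatrixMultiplication.MatrixMultiplication.Theses.DesignFlattening.Assembly
  intro hH hA hX
  rw [_root_.MatrixMultiplication_iff]
  refine le_antisymm ?_ (omega_two_le ℂ)
  exact le_of_forall_pos_le_add fun η hη => designFlattening_omega_le_two_add hH hA hX hη

end Summit.MatrixMultiplication.MatrixMultiplication.Theorems
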